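import Summits.QuantumFields.YangMills.Theorems.AlphaInputsT3ACv3StartDefectBox
import Summits.QuantumFields.YangMills.Theorems.AlphaInputsT3ACv3RegionSection
import Literature.MathematicalPhysics.QuantumFieldTheory.Balaban1983to89.B10Eq38TorusDomains
import HarnessLib

/-!
# `AlphaInputsT3ACv3StartCertSmall` — START for the (FL) `hLift` binder, SMALL-k ESCAPE (`L^k < 16`): **THE SECTION ITSELF IS THE START** — `U₀ := iterSec k V`; (P) every constrained
# plaquette has `dist1 U₀(∂q) ≤ ε′ ≤ 256·ε′∕(L^k)²` (★w1 g2's `RegionSection.dist1_plaqHol_iterSec_le`; under a displayed level-by-level SATURATION of Ω); (D) its `k`-fold averages ARE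
# `V` (`iter_iterSec`), so the defect row holds with `η₀ = 0` — the two START rows of the M22 junction for `L^k < 16` with no tubes and no balls (B absorbs `16² = 256`) — lane
# `pub-balaban3d` ∕ cell `ym3-torus`, seat `ym-ust-19936-w1` (g2, LEAD)

WHY (bus PROGRESS 3 «SMALL-k ESCAPE», OWNER 03:29Z-label «SMALL-k escape as you say»; PROGRESS 7).  The canonical tube∕ball system needs `16 ≤ L^k` (`r ≥ 1`, `R < ⌊L^k∕2⌋`); below that the
section's own plaquettes `≤ ε′` already meet the window `B·ε′·L^{−2k}` with `B ≥ 256`, and its averages are exact.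
WHAT IS HERE: `sq_le_of_lt_sixteen` (numeral), ★★`startSmall_cert` (generic `Params`, any `SU(n)`).
HONEST FRAMING.  Bookkeeping; (FL)∕`hLift` NOT proved; count-neutral helper toward R3 2′ (items 19936∕19935); registry untouched; nothing about d = 4, the continuum, or a mass gap;
YM₃ on T³ is rung R3, not Clay.

References: T. Bałaban, Commun. Math. Phys. 102 (1985) 277–309 [Balaban1985Variational] ((11) p.279, Thm 1 (8) p.279).
-/

set_option autoImplicit false

noncomputable section

open scoped Matrix.Norms.L2Operator

namespace Summit.QuantumFields.YangMills.Theorems.TubeStart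

open Literature.MathematicalPhysics.QuantumFieldTheory.Balaban1983to89
open T4Continuum BlockAveraging ExpMeanLog
open Literature.MathematicalPhysics.QuantumFieldTheory.Balaban1983to89.BlockAveragingSectionAction (iterSec iter_iterSec)
open Literature.MathematicalPhysics.QuantumFieldTheory.Balaban1983to89.B10Eq38TorusDomains (toFine plaqsIn cornerSet mem_plaqsIn_iff)
open Literature.MathematicalPhysics.QuantumFieldTheory.Balaban1983to89.T3DescentFibreTower (expMeanLogSU_E_one)
open Summit.QuantumFields.YangMills.Theorems.Prop7HolRatioPerStep (coe_mul_star_self)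

variable {P : Params} {n : Type*} [Fintype n] [DecidableEq n] [Nonempty n] (k : ℕ) (Ω : Set (Site P 0)) (V : GaugeField P k (Matrix.specialUnitaryGroup n ℂ))

/-- `L^k < 16 ⇒ 1 ≤ 256∕(L^k)²` as reals (`1 ≤ L^k`). [folklore] -/
theorem one_le_div_sq_of_lt_sixteen (hL1 : 1 ≤ P.L ^ k) (hLk : P.L ^ k < 16) : (1 : ℝ) ≤ 256 / ((P.L ^ k : ℕ) : ℝ) ^ 2 := by
  have h1 : (1 : ℝ) ≤ ((P.L ^ k : ℕ) : ℝ) := by exact_mod_cast hL1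
  have h2 : ((P.L ^ k : ℕ) : ℝ) ≤ 15 := by exact_mod_cast (by omega : P.L ^ k ≤ 15)
  rw [le_div_iff₀ (by positivity)]
  nlinarith

open Classical in
/-- **★★ THE SMALL-k START CERTIFICATE**: for `L^k < 16`, with `U₀ := iterSec k V`: (P) `dist1 U₀(∂q) ≤ 256·ε′∕(L^k)²` on `plaqsIn 0 Ω`, given `dist1 V(∂Q) ≤ ε′` on `plaqsIn k Ω` and the
LEVEL-BY-LEVEL SATURATION of Ω (`toFine s z ∈ Ω ↔ toFine (s+1) (blockOf z) ∈ Ω` for `s < k`); (D) `avg^k U₀ = V` exactly, hence `‖avg^k U₀(c)·V(c)* − 1‖ ≤ 0` on every coarse bond.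
[cite: Balaban1985Variational, (11) p.279, Thm 1 (8) p.279] -/
theorem startSmall_cert (hk : k ≤ P.m + P.K) (hLk : P.L ^ k < 16) {ε' : ℝ} (hε0 : 0 ≤ ε')
    (hsatR : ∀ s, s < k → ∀ z : Site P s, toFine s z ∈ Ω ↔ toFine (s + 1) (blockOf z) ∈ Ω)
    (hV : ∀ Q, Q ∈ plaqsIn k Ω → GaugeGroup.dist1 (GaugeField.plaqHol V Q) ≤ ε') :
    (∀ q : Plaq P 0, q ∈ plaqsIn 0 Ω → GaugeGroup.dist1 (GaugeField.plaqHol (iterSec k V) q) ≤ 256 * ε' / ((P.L ^ k : ℕ) : ℝ) ^ 2) ∧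
    (Averaging.iter (fun i => (blockAvg (expMeanLogSU (n := n)) : Averaging P i (Matrix.specialUnitaryGroup n ℂ))) k (iterSec k V) = V) ∧
    (∀ c : PBond P k,
      ‖((Averaging.iter (fun i => (blockAvg (expMeanLogSU (n := n)) : Averaging P i (Matrix.specialUnitaryGroup n ℂ))) k (iterSec k V) c :
          Matrix.specialUnitaryGroup n ℂ) : Matrix n n ℂ) * star ((V c : Matrix.specialUnitaryGroup n ℂ) : Matrix n n ℂ) - 1‖ ≤ 0) := by
  have hsec : Averaging.iter (fun i => (blockAvg (expMeanLogSU (n := n)) : Averaging P i (Matrix.specialUnitaryGroup n ℂ))) k (iterSec k V) = V :=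
    iter_iterSec (expMeanLogSU (n := n)) expMeanLogSU_E_one k hk V
  refine ⟨fun q hq => ?_, hsec, fun c => ?_⟩
  · -- (P): the regional dichotomy with the nested family `R s := {z | toFine s z ∈ Ω}`
    have hcorn := mem_plaqsIn_iff.mp hq
    simp only [cornerSet, Set.insert_subset_iff, Set.singleton_subset_iff, B10Eq38TorusDomains.toFine_zero] at hcorn
    obtain ⟨h1, h2, h3, h4⟩ := hcorn
    have hW : ∀ Q : Plaq P k, Q.src ∈ {z : Site P k | toFine k z ∈ Ω} → Q.src.shift Q.μ ∈ {z : Site P k | toFine k z ∈ Ω} →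
        Q.src.shift Q.ν ∈ {z : Site P k | toFine k z ∈ Ω} → (Q.src.shift Q.μ).shift Q.ν ∈ {z : Site P k | toFine k z ∈ Ω} →
        GaugeGroup.dist1 (GaugeField.plaqHol V Q) ≤ ε' := by
      intro Q hQ1 hQ2 hQ3 hQ4
      apply hV Q
      rw [mem_plaqsIn_iff]
      simp only [cornerSet, Set.insert_subset_iff, Set.singleton_subset_iff]
      exact ⟨hQ1, hQ2, hQ3, hQ4⟩
    have hε := RegionSection.dist1_plaqHol_iterSec_le k hk (fun s => {z : Site P s | toFine s z ∈ Ω}) (fun s hs z => hsatR s hs z) V hε0 hW q h1 h2 h3 h4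
    have hL1 : 1 ≤ P.L ^ k := Nat.one_le_pow _ _ P.L_pos
    calc GaugeGroup.dist1 (GaugeField.plaqHol (iterSec k V) q) ≤ ε' := hε
      _ = ε' * 1 := (mul_one _).symm
      _ ≤ ε' * (256 / ((P.L ^ k : ℕ) : ℝ) ^ 2) := mul_le_mul_of_nonneg_left (one_le_div_sq_of_lt_sixteen k hL1 hLk) hε0
      _ = 256 * ε' / ((P.L ^ k : ℕ) : ℝ) ^ 2 := by ring
  · -- (D): exact averages
    rw [hsec, coe_mul_star_self, sub_self, norm_zero]

end Summit.QuantumFields.YangMills.Theorems.TubeStart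

end
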